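import Mathlib.Data.Rat.Defs
import Mathlib.Data.Real.Basic
import Mathlib.Data.List.Basic
import Mathlib.LinearAlgebra.Matrix.PosDef
import Mathlib.Algebra.Order.Star.Real
import Mathlib.Data.List.GetD
import Literature.Computation.Certificates.Data
import Summits.NavierStokesRegularity.TurbBounds.GramStream
import HarnessLib

/-!
# Row-batched sparse assembly of affine block rules (evaluator tooling, shear lane; pilot)

Cell `turb-bounds` (pub-turb), pub-turb-shear gen 5 (2026-08-21) — design note `lean-t12/EVAL-FW16-DESIGN.md`, pilot results 1–4.
An EVALUATOR identity `A = den • (c₀·P₀ + c₁·P₁ + … )` (rbsdp SPEC 2.8 / FORMAT-rbcert0 §2c: the certified integer matrix is the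
affine block rule at the row's data) is checked in the kernel by ASSEMBLING the right-hand side as dense rational rows from SPARSE
piece rows: `scatterRow c row js vs 0` adds `c·v` at the listed columns of one dense row in a single walk, `addPieceRows` does this for
every row of a piece with one `List.zipWith3`. This file proves the MEANING of that computation once:
* `densifyRow n js vs` := the dense row of a sparse row (defined by the same walk with `c = 1` from the zero row);
* `scatterRow_eq_add` : `scatterRow c xs js vs pos = zipWith (x + c·y) xs (walk from zeros)` — for ALL inputs (no sortedness needed:
  both sides drop exactly the same ill-placed entries), hence
* `getD_addPieceRows` : entry `(i, j)` of `addPieceRows c acc js vs` = entry of `acc` + `c` · entry of the densified piece, and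
* `matrixOfRows_addPieceRows` : `matrixOfRows n n (addPieceRows c acc js vs) = matrixOfRows n n acc + c • matrixOfRows n n (densify n js vs)`;
* `length_addPieceRows`, `length_getD_addPieceRows` : the shape is preserved, so additions chain;
* `assemble` / `pieceSum` / `matrixOfRows_assemble` : a whole list of (coefficient, piece) folded from zeros IS the piece sum;
* (in `PieceAssemblyWF.lean`: `rowWF` / `piecesWF` and the semantics lemmas `getD_densifyRow` / `matrixOfRows_densify_apply` —
  with strictly increasing column lists the walk drops nothing, each densified entry IS the listed value or `0`);
* `scalePieces` / `pieceSum_scalePieces` / `posSemidef_of_eq_smul` : `A = den • Q_m` with `A ⪰ 0` (the landed block) and `den > 0`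
  gives `Q_m ⪰ 0` over `ℝ` — the affine rule's VALUE at the row's data is positive semidefinite (what rbsdp SPEC 2.9 / 3.7 consume).
So a chain of `addPieceRows` starting from the zero rows IS `Σ c_q • (piece q as a matrix)`, and a kernel `decide` on
`assembled = B.A_rows` proves the evaluator identity with the pieces read as `matrixOfRows n n (densify n js_q vs_q)`.
Measured (pilot 4): R-C200 mode 2 (n 58, 15 pieces, 2 287 nnz) 13.4 s. STAGED ONLY (v2; needs a lead). 
HONEST FRAMING: rigorous bounds for the stated PDE and boundary conditions; no claim about physical turbulence beyond the bound.
-/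

namespace Summit.NavierStokesRegularity.TurbBounds.PieceAssembly

open Literature.Computation.Certificates

/-- Scatter-add `c·(sparse row)` (columns `js`, values `vs`) into a dense row, walking the dense row once from position `pos`. -/
def scatterRow (c : ℚ) : List ℚ → List ℕ → List ℚ → ℕ → List ℚ
  | x :: xs, j :: js, v :: vs, pos =>
      if j = pos then (x + c * v) :: scatterRow c xs js vs (pos + 1) else x :: scatterRow c xs (j :: js) (v :: vs) (pos + 1)
  | xs, _, _, _ => xs

/-- Add a piece given as sparse rows (per-row column lists `js` and value lists `vs`) with coefficient `c`: one `zipWith3` over rows. -/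
def addPieceRows (c : ℚ) (acc : List (List ℚ)) (js : List (List ℕ)) (vs : List (List ℚ)) : List (List ℚ) :=
  List.zipWith3 (fun row j v => scatterRow c row j v 0) acc js vs

/-- The dense row (length `len`, read from position `pos`) of a sparse row: the same walk from the zero row with coefficient 1. -/
def densifyRowFrom (len : ℕ) (js : List ℕ) (vs : List ℚ) (pos : ℕ) : List ℚ := scatterRow 1 (List.replicate len 0) js vs pos

/-- The dense `n`-row of a sparse row. -/
def densifyRow (n : ℕ) (js : List ℕ) (vs : List ℚ) : List ℚ := densifyRowFrom n js vs 0

/-- The dense rows of a sparse piece (row by row). -/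
def densify (n : ℕ) (js : List (List ℕ)) (vs : List (List ℚ)) : List (List ℚ) :=
  List.zipWith (fun j v => densifyRow n j v) js vs

/-- `scatterRow` with no columns left is the identity. -/
theorem scatterRow_nil_left (c : ℚ) : ∀ (xs : List ℚ) (vs : List ℚ) (pos : ℕ), scatterRow c xs [] vs pos = xs
  | [], _, _ => rfl
  | _ :: _, _, _ => rfl

/-- `scatterRow` with no values left is the identity. -/
theorem scatterRow_nil_right (c : ℚ) : ∀ (xs : List ℚ) (js : List ℕ) (pos : ℕ), scatterRow c xs js [] pos = xs
  | [], _, _ => rfl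
  | _ :: _, [], _ => rfl
  | _ :: _, _ :: _, _ => rfl

/-- Length is preserved. -/
theorem length_scatterRow (c : ℚ) : ∀ (xs : List ℚ) (js : List ℕ) (vs : List ℚ) (pos : ℕ),
    (scatterRow c xs js vs pos).length = xs.length
  | [], js, vs, pos => by cases js <;> cases vs <;> rfl
  | x :: xs, [], vs, pos => by rw [scatterRow_nil_left]
  | x :: xs, j :: js, [], pos => by rw [scatterRow_nil_right]
  | x :: xs, j :: js, v :: vs, pos => by
      simp only [scatterRow]
      split
      · simp [length_scatterRow c xs js vs (pos + 1)]
      · simp [length_scatterRow c xs (j :: js) (v :: vs) (pos + 1)]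

/-- **Meaning of the walk.** Scattering into `xs` equals `xs` plus `c` times the scatter into zeros, entry by entry — for ALL inputs. -/
theorem scatterRow_eq_add (c : ℚ) : ∀ (xs : List ℚ) (js : List ℕ) (vs : List ℚ) (pos : ℕ),
    scatterRow c xs js vs pos =
      List.zipWith (fun x y => x + c * y) xs (scatterRow 1 (List.replicate xs.length 0) js vs pos)
  | [], js, vs, pos => by cases js <;> cases vs <;> rfl
  | x :: xs, [], vs, pos => by
      rw [scatterRow_nil_left, scatterRow_nil_left]
      exact (zipWith_replicate_zero c (x :: xs)).symm
  | x :: xs, j :: js, [], pos => by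
      rw [scatterRow_nil_right, scatterRow_nil_right]
      exact (zipWith_replicate_zero c (x :: xs)).symm
  | x :: xs, j :: js, v :: vs, pos => by
      simp only [scatterRow, List.length_cons, List.replicate_succ]
      split
      · simp only [List.zipWith_cons_cons, zero_add, one_mul]
        rw [scatterRow_eq_add c xs js vs (pos + 1)]
      · simp only [List.zipWith_cons_cons, mul_zero, add_zero]
        rw [scatterRow_eq_add c xs (j :: js) (v :: vs) (pos + 1)]
where
  /-- `zipWith (x + c·y) xs (zeros) = xs`. -/
  zipWith_replicate_zero (c : ℚ) : ∀ (xs : List ℚ),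
      List.zipWith (fun x y => x + c * y) xs (List.replicate xs.length 0) = xs
    | [] => rfl
    | x :: xs => by
        simp only [List.length_cons, List.replicate_succ, List.zipWith_cons_cons, mul_zero, add_zero]
        rw [zipWith_replicate_zero c xs]

/-- Positional reading of `List.zipWith3` (all lists long enough). -/
theorem getD_zipWith3 {α β γ δ : Type*} (f : α → β → γ → δ) (da : α) (db : β) (dc : γ) (dd : δ) :
    ∀ (l : List α) (l' : List β) (l'' : List γ) (i : ℕ), i < l.length → i < l'.length → i < l''.length →
      (List.zipWith3 f l l' l'').getD i dd = f (l.getD i da) (l'.getD i db) (l''.getD i dc)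
  | [], _, _, i, h1, _, _ => absurd h1 (Nat.not_lt_zero i)
  | _ :: _, [], _, i, _, h2, _ => absurd h2 (Nat.not_lt_zero i)
  | _ :: _, _ :: _, [], i, _, _, h3 => absurd h3 (Nat.not_lt_zero i)
  | a :: as, b :: bs, e :: es, 0, _, _, _ => rfl
  | a :: as, b :: bs, e :: es, i + 1, h1, h2, h3 => by
      simp only [List.zipWith3, List.getD_cons_succ]
      exact getD_zipWith3 f da db dc dd as bs es i (by simpa using h1) (by simpa using h2) (by simpa using h3)

/-- Length of `List.zipWith3` when all three lists have length `n`. -/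
theorem length_zipWith3_eq {α β γ δ : Type*} (f : α → β → γ → δ) :
    ∀ (l : List α) (l' : List β) (l'' : List γ) (n : ℕ), l.length = n → l'.length = n → l''.length = n →
      (List.zipWith3 f l l' l'').length = n
  | [], _, _, n, h1, _, _ => by simpa [List.zipWith3] using h1
  | _ :: _, [], _, n, _, h2, _ => by simp at h2; subst h2; rfl
  | _ :: _, _ :: _, [], n, _, _, h3 => by simp at h3; subst h3; rfl
  | a :: as, b :: bs, e :: es, n, h1, h2, h3 => by
      cases n with
      | zero => simp at h1
      | succ n =>
        simp only [List.length_cons, Nat.add_right_cancel_iff] at h1 h2 h3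
        simp only [List.zipWith3, List.length_cons, length_zipWith3_eq f as bs es n h1 h2 h3]

/-- **Entry semantics of one scattered row**: entry `k` of `scatterRow c xs js vs 0` = `xs k + c · (densifyRow xs.length js vs) k`. -/
theorem getD_scatterRow (c : ℚ) (xs : List ℚ) (js : List ℕ) (vs : List ℚ) (k : ℕ) (hk : k < xs.length) :
    (scatterRow c xs js vs 0).getD k 0 = xs.getD k 0 + c * (densifyRow xs.length js vs).getD k 0 := by
  rw [scatterRow_eq_add]
  have hlen : k < (scatterRow 1 (List.replicate xs.length 0) js vs 0).length := by
    rw [length_scatterRow, List.length_replicate]; exact hk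
  rw [GramStream.getD_zipWith _ (0 : ℚ) (0 : ℚ) (0 : ℚ) xs _ k hk hlen]
  rfl

/-- **Entry semantics of `addPieceRows`**: for rows `i < n` present in all three lists and columns `k` inside row `i` of `acc`,
entry `(i, k)` = `acc` entry + `c` · densified-piece entry. -/
theorem getD_addPieceRows (c : ℚ) (acc : List (List ℚ)) (js : List (List ℕ)) (vs : List (List ℚ)) (i k : ℕ)
    (hi : i < acc.length) (hij : i < js.length) (hiv : i < vs.length) (hk : k < (acc.getD i []).length) :
    ((addPieceRows c acc js vs).getD i []).getD k 0 =
      (acc.getD i []).getD k 0 + c * (densifyRow (acc.getD i []).length (js.getD i []) (vs.getD i [])).getD k 0 := by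
  unfold addPieceRows
  rw [getD_zipWith3 _ ([] : List ℚ) ([] : List ℕ) ([] : List ℚ) ([] : List ℚ) acc js vs i hi hij hiv]
  exact getD_scatterRow c _ _ _ k hk

/-- **Matrix form**: `matrixOfRows n n (addPieceRows c acc js vs) = matrixOfRows n n acc + c • matrixOfRows n n (densify n js vs)`. -/
theorem matrixOfRows_addPieceRows {n : ℕ} (c : ℚ) {acc : List (List ℚ)} {js : List (List ℕ)} {vs : List (List ℚ)}
    (hacc : acc.length = n) (hrow : ∀ i < n, (acc.getD i []).length = n) (hjs : js.length = n) (hvs : vs.length = n) :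
    matrixOfRows n n (addPieceRows c acc js vs) = matrixOfRows n n acc + c • matrixOfRows n n (densify n js vs) := by
  ext i k
  simp only [matrixOfRows_apply, Matrix.add_apply, Matrix.smul_apply, smul_eq_mul]
  have hi : i.val < acc.length := hacc ▸ i.isLt
  have hk : k.val < (acc.getD i.val []).length := (hrow i.val i.isLt).symm ▸ k.isLt
  rw [getD_addPieceRows c acc js vs i.val k.val hi (hjs ▸ i.isLt) (hvs ▸ i.isLt) hk, hrow i.val i.isLt]
  congr 2
  unfold densify
  rw [GramStream.getD_zipWith _ ([] : List ℕ) ([] : List ℚ) ([] : List ℚ) js vs i.val (hjs ▸ i.isLt) (hvs ▸ i.isLt)]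

/-- Shape is preserved by a piece addition (so additions chain): `n` rows … -/
theorem length_addPieceRows {n : ℕ} (c : ℚ) {acc : List (List ℚ)} {js : List (List ℕ)} {vs : List (List ℚ)}
    (hacc : acc.length = n) (hjs : js.length = n) (hvs : vs.length = n) : (addPieceRows c acc js vs).length = n := by
  unfold addPieceRows
  exact length_zipWith3_eq _ acc js vs n hacc hjs hvs

/-- … each of length `n`. -/
theorem length_getD_addPieceRows {n : ℕ} (c : ℚ) {acc : List (List ℚ)} {js : List (List ℕ)} {vs : List (List ℚ)}
    (hacc : acc.length = n) (hrow : ∀ i < n, (acc.getD i []).length = n) (hjs : js.length = n) (hvs : vs.length = n)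
    (i : ℕ) (hi : i < n) : ((addPieceRows c acc js vs).getD i []).length = n := by
  unfold addPieceRows
  rw [getD_zipWith3 _ ([] : List ℚ) ([] : List ℕ) ([] : List ℚ) ([] : List ℚ) acc js vs i (hacc ▸ hi) (hjs ▸ hi) (hvs ▸ hi),
    length_scatterRow, hrow i hi]

/-! ### Tests (kernel) -/

/-- A 3×3 example: zeros + 2·(sparse piece with rows {(0,0)=1,(0,2)=5}, {}, {(2,1)=7}) . -/
example : addPieceRows 2 [[0, 0, 0], [0, 0, 0], [0, 0, 0]] [[0, 2], [], [1]] [[1, 5], [], [7]] =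
    [[2, 0, 10], [0, 0, 0], [0, 14, 0]] := by decide +kernel

example : densify 3 [[0, 2], [], [1]] [[1, 5], [], [7]] = [[1, 0, 5], [0, 0, 0], [0, 7, 0]] := by decide +kernel

/-! ### Whole-rule assembly: a list of (coefficient, sparse piece) folded from the zero rows -/

/-- The zero `n × n` rows. -/
def zeroRows (n : ℕ) : List (List ℚ) := List.replicate n (List.replicate n 0)

/-- Assemble `Σ_q c_q · piece_q` as dense rows: fold `addPieceRows` over the pieces `(c_q, js_q, vs_q)` from the zero rows. -/
def assemble (n : ℕ) (pieces : List (ℚ × List (List ℕ) × List (List ℚ))) : List (List ℚ) :=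
  pieces.foldl (fun acc p => addPieceRows p.1 acc p.2.1 p.2.2) (zeroRows n)

/-- The same combination as a `Matrix`: `Σ_q c_q • matrixOfRows n n (densify n js_q vs_q)` (left fold from `0`). -/
def pieceSum (n : ℕ) (pieces : List (ℚ × List (List ℕ) × List (List ℚ))) : Matrix (Fin n) (Fin n) ℚ :=
  pieces.foldl (fun M p => M + p.1 • matrixOfRows n n (densify n p.2.1 p.2.2)) 0

/-- Fold invariant: assembling onto well-shaped rows `acc` adds the piece sum to `matrixOfRows n n acc`. -/
theorem matrixOfRows_foldl_addPieceRows {n : ℕ} :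
    ∀ (pieces : List (ℚ × List (List ℕ) × List (List ℚ))) (acc : List (List ℚ)) (M : Matrix (Fin n) (Fin n) ℚ),
      (∀ p ∈ pieces, p.2.1.length = n ∧ p.2.2.length = n) → acc.length = n → (∀ i < n, (acc.getD i []).length = n) →
      matrixOfRows n n acc = M →
      matrixOfRows n n (pieces.foldl (fun acc p => addPieceRows p.1 acc p.2.1 p.2.2) acc) =
        pieces.foldl (fun M p => M + p.1 • matrixOfRows n n (densify n p.2.1 p.2.2)) M
  | [], acc, M, _, _, _, hM => by simp [hM]
  | p :: ps, acc, M, hp, hacc, hrow, hM => by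
      have hp1 := (hp p (by simp)).1
      have hp2 := (hp p (by simp)).2
      simp only [List.foldl_cons]
      apply matrixOfRows_foldl_addPieceRows ps _ _ (fun q hq => hp q (by simp [hq]))
        (length_addPieceRows p.1 hacc hp1 hp2) (length_getD_addPieceRows p.1 hacc hrow hp1 hp2)
      rw [matrixOfRows_addPieceRows p.1 hacc hrow hp1 hp2, hM]

/-- Positional reading of a `replicate`. -/
theorem getD_replicate_of_lt {α : Type*} (a d : α) {n i : ℕ} (h : i < n) : (List.replicate n a).getD i d = a := by
  simp [List.getD_eq_getElem?_getD, h]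

/-- The zero rows read as the zero matrix. -/
theorem matrixOfRows_zeroRows (n : ℕ) : matrixOfRows n n (zeroRows n) = 0 := by
  ext i j
  simp only [matrixOfRows_apply, zeroRows, Matrix.zero_apply]
  rw [getD_replicate_of_lt _ _ i.isLt, getD_replicate_of_lt _ _ j.isLt]

/-- **Assembly = piece sum.** For pieces whose sparse-row lists all have `n` rows,
`matrixOfRows n n (assemble n pieces) = pieceSum n pieces`. So a kernel `decide` on `assemble n pieces = A_rows` proves
`matrixOfRows n n A_rows = Σ_q c_q • (piece q as a matrix)`. -/
theorem matrixOfRows_assemble {n : ℕ} (pieces : List (ℚ × List (List ℕ) × List (List ℚ)))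
    (hp : ∀ p ∈ pieces, p.2.1.length = n ∧ p.2.2.length = n) :
    matrixOfRows n n (assemble n pieces) = pieceSum n pieces := by
  unfold assemble pieceSum
  refine matrixOfRows_foldl_addPieceRows pieces (zeroRows n) 0 hp (by simp [zeroRows]) (fun i hi => ?_) (matrixOfRows_zeroRows n)
  simp only [zeroRows]
  rw [getD_replicate_of_lt _ _ hi, List.length_replicate]

/-- Test: two pieces on 2×2. -/
example : matrixOfRows 2 2 (assemble 2 [(2, [[0], [1]], [[1], [1]]), (3, [[1], []], [[1], []])]) =
    pieceSum 2 [(2, [[0], [1]], [[1], [1]]), (3, [[1], []], [[1], []])] :=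
  matrixOfRows_assemble _ (by decide)

example : assemble 2 [(2, [[0], [1]], [[1], [1]]), (3, [[1], []], [[1], []])] = [[2, 3], [0, 2]] := by decide +kernel

/-! ### Scaling and positivity of the rule value -/

/-- Scale every coefficient of a piece list by `d`. -/
def scalePieces (d : ℚ) (ps : List (ℚ × List (List ℕ) × List (List ℚ))) : List (ℚ × List (List ℕ) × List (List ℚ)) :=
  ps.map fun p => (d * p.1, p.2)

/-- Fold invariant for scaling: folding the scaled pieces from `d • M` gives `d •` (folding the pieces from `M`). -/
theorem foldl_scalePieces {n : ℕ} (d : ℚ) :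
    ∀ (ps : List (ℚ × List (List ℕ) × List (List ℚ))) (M : Matrix (Fin n) (Fin n) ℚ),
      (scalePieces d ps).foldl (fun M p => M + p.1 • matrixOfRows n n (densify n p.2.1 p.2.2)) (d • M) =
        d • ps.foldl (fun M p => M + p.1 • matrixOfRows n n (densify n p.2.1 p.2.2)) M
  | [], M => rfl
  | p :: ps, M => by
      simp only [scalePieces, List.map_cons, List.foldl_cons]
      have : d • M + (d * p.1) • matrixOfRows n n (densify n p.2.1 p.2.2) =
          d • (M + p.1 • matrixOfRows n n (densify n p.2.1 p.2.2)) := by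
        rw [smul_add, mul_smul]
      rw [this]
      exact foldl_scalePieces d ps _

/-- **Scaled piece sum**: `pieceSum n (scalePieces d ps) = d • pieceSum n ps`. -/
theorem pieceSum_scalePieces {n : ℕ} (d : ℚ) (ps : List (ℚ × List (List ℕ) × List (List ℚ))) :
    pieceSum n (scalePieces d ps) = d • pieceSum n ps := by
  unfold pieceSum
  have h := foldl_scalePieces (n := n) d ps 0
  rw [smul_zero] at h
  exact h

/-- **Positivity passes to the rule value.** If the certified matrix `A` (PSD over `ℝ`, as every landed block states) equals `d • Q` with
`0 < d`, then `Q` — the affine rule's value at the row's data — is PSD over `ℝ`. -/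
theorem posSemidef_of_eq_smul {n : ℕ} {A Q : Matrix (Fin n) (Fin n) ℚ} {d : ℚ} (hd : 0 < d) (h : A = d • Q)
    (hA : (A.map (Rat.cast : ℚ → ℝ)).PosSemidef) : (Q.map (Rat.cast : ℚ → ℝ)).PosSemidef := by
  have hQ : Q = d⁻¹ • A := by rw [h, smul_smul, inv_mul_cancel₀ (ne_of_gt hd), one_smul]
  have hmap : (Q.map (Rat.cast : ℚ → ℝ)) = ((d⁻¹ : ℚ) : ℝ) • A.map (Rat.cast : ℚ → ℝ) := by
    ext i j
    simp [hQ, Matrix.map_apply, Matrix.smul_apply, Rat.cast_mul]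
  rw [hmap]
  exact hA.smul (by exact_mod_cast (inv_pos.mpr hd).le)

end Summit.NavierStokesRegularity.TurbBounds.PieceAssembly
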